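import Summits.RiemannHypothesis.RiemannHypothesis.Theorems.PfPersistenceInWindowMirror
import Summits.RiemannHypothesis.RiemannHypothesis.Theorems.PfPersistenceGalerkinTestDensity
import Summits.RiemannHypothesis.RiemannHypothesis.Theorems.SpectralTraceWindowStepConjugateSplit
import HarnessLib

/-!
# PF persistence — the GALERKIN TWIN of the Grönwall transport laws (MONO-F / T-B∫): typed class, placement, and
# the SHAPE OBSTRUCTION to an `InG1contU` certificate (pub-rhpf cand-3 gen 7, slot S4 (a); RULING A101 (a1))

**HONEST FRAMING. This is a long-odds MECHANISM / RIGIDITY campaign; no RH claims.** RH-free bookkeeping about the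
cell's records (`Datum` = even blocks of the truncated Weil form at every window `(a, N)`), except §6, whose theorems
are CONDITIONAL reductions "`ζ` in the class ⇒ RH" that nobody can feed (RH-strength label E1; they credit nothing).

CONTEXT. transport-1's law of record (GAP-CLASSES row TR1-MONOF; continuum form `PfPersistenceTransport`
4704baf3ef3f): `ε(a') ≥ c · ε(a) · e^{-4π(e^{2a'} - e^{2a})}` for `a₀ ≤ a < a'`, `c = 0.76` at all strides / `c = 1`
at strides `≥ 0.04` (DATA ζ: 1865 rows, `a ≤ 2.1`, `N ≤ 1000`). RULING A101 (a1): door E1 "by description", and NO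
formal `InG1contU` certificate issued ("non-strict inequalities; `IsWindowwiseOpen` not automatic"). This file types
the GALERKIN TWIN a window reader actually tests (same `N`, heights `a < a'`, bottoms `ε₁ = bottomRayleigh`):
* §1–§2 `scalarDatum` / `patchDatum` (test data with scalar blocks); the class `transportTwin a₀ h c Φ T` =
  `{d | ∀ N, ∀ a₀ ≤ a < a', a + h ≤ a', both windows in T: c · Φ(a) · ε₁(d(a,N)) ≤ Φ(a') · ε₁(d(a',N))}`; members
  of record `monoFTwin` (`h = 0, c = 0.76`) / `monoFStrideTwin` (`h = 0.04, c = 1`), gauge `archGauge = e^{4πe^{2a}}`.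
  (Finite-anchor step readers are the typer's `sectorStepReaderOn`, 8dbe49ede289; here the law binds ALL pairs of `T`.)
* §3 PLACEMENT (PROVED): `DeterminedOn T`; for `T ⊆ below A` (served `a ≤ 2.1`) inside wall W1 and failing clause (2).
* §4 **SHAPE OBSTRUCTION (PROVED): a transport law is NOT WINDOW-WISE.** `IsWindowwise S` (a fortiori
  `IsWindowwiseOpen S`) makes `S` a PRODUCT over windows, closed under exchanging one window's block between members
  (`IsWindowwise.mem_of_mix`); the constant data `0`, `1` are members of every twin (`0 ≤ c ≤ 1`, gauge monotone,
  positive) but their exchange at the lower window of one admissible pair is not. Hence `¬ IsWindowwise`,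
  `¬ InG1cont`, `¬ InG1contU`, `¬ InG1int` for EVERY `T` holding one admissible pair, bounded or not, strict or
  non-strict alike. A101 (a1)'s "not issued" is formally "IMPOSSIBLE BY SHAPE": the G1 classes as typed
  (`PfPersistenceGapClassG1`) admit only product presentations; a two-window COUPLING is not one. (Whether clause (1)
  should read "open in the product topology" instead is for the adjudicators; no claim here.)
* §5 clause (2) HOLDS on `T = univ` (PROVED): decided at no bounded height, so not finitely determined (outside W1).
* §6 STRENGTH (PROVED, CONDITIONAL, credit nothing): (i) SELF-SEEDING — `h = 0`, `0 ≤ c < 1`: every member has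
  `ε₁ ≥ 0` at every window above `max a₀ 0` (chain the law through midpoints, `c^n → 0`), so
  `ζ ∈ monoFTwin a₀ univ ⇒ RH` for EVERY `a₀` (`riemannHypothesis_of_galerkinFloorSeq`, 8bfafb17c1e9); (ii) SEEDED —
  any `c > 0`, any `h`: a seed `0 < ε_ev(aₛ)`, `a₀ ≤ aₛ` (PROVED below `log 3 / 2`; Rayleigh–Ritz
  `weilEvenGroundEnergy_le_bottomRayleigh'` 8501942ea7d9 makes it uniform in `N`) transports to `ε₁ > 0` far out, so
  `ζ ∈ monoFStrideTwin a₀ univ ⇒ RH` for `a₀ < log 3 / 2` — the datum-side twin of transport-1's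
  `riemannHypothesis_of_archTransportFrom'` and the kernel form of RULING A104's "thermometer-carried".
Labels: PROVED = kernel-checked here; DATA = the cell's tables (not re-run); RULED = ADJ-LOG. No RH claims.
-/

set_option linter.dupNamespace false  -- the mandated namespace repeats `RiemannHypothesis`

noncomputable section

open Real Set Filter Matrix
open scoped Topology
open Literature.NumberTheory.LFunctions
open Summit.RiemannHypothesis.RiemannHypothesis.Theorems.SpectralTraceWindowStep
  (weilGroundEnergy_pos_of_lt_log_three_half')

namespace Summit.RiemannHypothesis.RiemannHypothesis.Theorems.PfPersistence

/-! ## §1 Scalar test data -/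

/-- SCALAR DATA: the datum whose block at every window is the scalar matrix `f win • 1` (bottom `= f win`). [folklore] -/
def scalarDatum (f : Window → ℝ) : Datum :=
  fun win => f win • (1 : Matrix (Fin (win.N + 1)) (Fin (win.N + 1)) ℝ)

open Classical in
/-- ONE-WINDOW PATCH: scalar block `x • 1` at the window `w₁`, `y • 1` everywhere else. [folklore] -/
def patchDatum (w₁ : Window) (x y : ℝ) : Datum :=
  scalarDatum fun w => if w = w₁ then x else y

/-- PROVED: the Rayleigh quotient of a scalar matrix is the scalar. [folklore] -/
theorem rayleigh_smul_one {n : ℕ} (b : ℝ) {v : Fin n → ℝ} (hv : v ≠ 0) :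
    v ⬝ᵥ ((b • (1 : Matrix (Fin n) (Fin n) ℝ)) *ᵥ v) / (v ⬝ᵥ v) = b := by
  have hvv : v ⬝ᵥ v ≠ 0 := fun h => hv (dotProduct_self_eq_zero.1 h)
  rw [Matrix.smul_mulVec, Matrix.one_mulVec, dotProduct_smul, smul_eq_mul, mul_div_assoc, div_self hvv, mul_one]

/-- PROVED: `ε₁(b • 1) = b` (positive dimension). [folklore] -/
theorem bottomRayleigh_smul_one (n : ℕ) (b : ℝ) :
    bottomRayleigh (b • (1 : Matrix (Fin (n + 1)) (Fin (n + 1)) ℝ)) = b := by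
  have hne : (fun _ : Fin (n + 1) => (1 : ℝ)) ≠ 0 := fun h => one_ne_zero (congr_fun h 0)
  exact le_antisymm ((bottomRayleigh_le_rayleigh _ hne).trans (rayleigh_smul_one b hne).le)
    (le_bottomRayleigh_of_forall _ fun v hv => (rayleigh_smul_one b hv).ge)

/-- PROVED: the bottom of scalar data is the prescribed scalar. [folklore] -/
@[simp] theorem bottomRayleigh_scalarDatum (f : Window → ℝ) (win : Window) :
    bottomRayleigh (scalarDatum f win) = f win :=
  bottomRayleigh_smul_one win.N (f win)

/-- PROVED: off the patched window the patch IS the constant datum `y`; at it, the constant datum `x`. [folklore] -/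
theorem patchDatum_of_ne {w₁ w : Window} (h : w ≠ w₁) (x y : ℝ) :
    patchDatum w₁ x y w = scalarDatum (fun _ => y) w := by
  simp [patchDatum, scalarDatum, h]

/-- PROVED: at the patched window the patch IS the constant datum `x`. [folklore] -/
theorem patchDatum_self (w₁ : Window) (x y : ℝ) : patchDatum w₁ x y w₁ = scalarDatum (fun _ => x) w₁ := by
  simp [patchDatum, scalarDatum]

/-! ## §2 The class: the Galerkin twin of an integrated transport law -/

/-- **TYPED — THE TRANSPORT TWIN** on the window set `T`, from height `a₀`, stride `h`, constant `c`, gauge `Φ`: for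
every `N` and all `a₀ ≤ a < a'`, `a + h ≤ a'`, both windows in `T`: `c · Φ(a) · ε₁(d(a, N)) ≤ Φ(a') · ε₁(d(a', N))`
(the integrated law `ε(a') ≥ c · ε(a) · Φ(a)/Φ(a')` of row TR1-MONOF, read on the served bottoms). [folklore] -/
def transportTwin (a₀ h c : ℝ) (Φ : ℝ → ℝ) (T : Set Window) : Set Datum :=
  {d | ∀ (N : ℕ) (a a' : ℝ) (ha : 0 < a) (ha' : 0 < a'), (⟨a, N, ha⟩ : Window) ∈ T → (⟨a', N, ha'⟩ : Window) ∈ T →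
    a₀ ≤ a → a < a' → a + h ≤ a' →
      c * (Φ a * bottomRayleigh (d ⟨a, N, ha⟩)) ≤ Φ a' * bottomRayleigh (d ⟨a', N, ha'⟩)}

/-- the ARCHIMEDEAN GAUGE of record `Φ(a) = e^{4π e^{2a}}` (MONO-F: `a ↦ Φ(a) ε(a)` non-decreasing). [folklore] -/
def archGauge (a : ℝ) : ℝ := Real.exp (4 * π * Real.exp (2 * a))

/-- PROVED: the gauge is positive. [folklore] -/
theorem archGauge_pos (a : ℝ) : 0 < archGauge a := Real.exp_pos _

/-- PROVED: the gauge is monotone. [folklore] -/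
theorem archGauge_monotone : Monotone archGauge := fun a b hab =>
  Real.exp_le_exp.2 (mul_le_mul_of_nonneg_left (Real.exp_le_exp.2 (by linarith)) (by positivity))

/-- the ALL-STRIDES member of record: `c = 0.76`, `h = 0` (T-B∫ quasi-monotone law, DATA-fitted constant). [folklore] -/
def monoFTwin (a₀ : ℝ) (T : Set Window) : Set Datum := transportTwin a₀ 0 0.76 archGauge T

/-- the STRIDE member of record: `c = 1` at strides `≥ 0.04` (MONO-F on the served grid). [folklore] -/
def monoFStrideTwin (a₀ : ℝ) (T : Set Window) : Set Datum := transportTwin a₀ 0.04 1 archGauge T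

/-! ## §3 Placement: decided on `T`; the bounded restriction is inside wall W1 and fails clause (2) -/

/-- PROVED: the twin on `T` reads only the windows of `T`. [folklore] -/
theorem determinedOn_transportTwin (a₀ h c : ℝ) (Φ : ℝ → ℝ) (T : Set Window) :
    DeterminedOn (transportTwin a₀ h c Φ T) T := by
  intro d d' hdd'
  simp only [transportTwin, mem_setOf_eq]
  constructor
  · intro hd N a a' ha ha' hT hT' h₀ hlt hs
    rw [← hdd' _ hT, ← hdd' _ hT']
    exact hd N a a' ha ha' hT hT' h₀ hlt hs
  · intro hd N a a' ha ha' hT hT' h₀ hlt hs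
    rw [hdd' _ hT, hdd' _ hT']
    exact hd N a a' ha ha' hT hT' h₀ hlt hs

/-- **PROVED — the served restriction is inside W1:** on a window set of bounded height (`T ⊆ below A`; served:
`a ≤ 2.1`) no transport twin separates `ζ` from the detectably negative data of a domain `⊇ arithDialSpace`. [folklore] -/
theorem not_separates_transportTwin_of_subset_below {D : Set Datum} (hD : arithDialSpace ⊆ D) {A : ℝ}
    {T : Set Window} (hT : T ⊆ below A) (a₀ h c : ℝ) (Φ : ℝ → ℝ) :
    ¬ Separates (transportTwin a₀ h c Φ T) D zetaDatum :=
  not_separates_of_determinedOn_below_arith hD ((determinedOn_transportTwin a₀ h c Φ T).mono hT)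

/-- PROVED: the bounded restriction fails clause (2) of G1, hence lies in none of `G1-cont`, `G1-contU`, `G1-int`.
[folklore] -/
theorem not_inG1_transportTwin_of_subset_below {A : ℝ} {T : Set Window} (hT : T ⊆ below A) (a₀ h c : ℝ)
    (Φ : ℝ → ℝ) :
    ¬ NonlocalAtEveryHeight (transportTwin a₀ h c Φ T) ∧ ¬ InG1cont (transportTwin a₀ h c Φ T) ∧
      ¬ InG1contU (transportTwin a₀ h c Φ T) ∧ ¬ InG1int (transportTwin a₀ h c Φ T) :=
  have h2 := not_nonlocalAtEveryHeight_of_determinedOn_below ((determinedOn_transportTwin a₀ h c Φ T).mono hT)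
  ⟨h2, fun hG => h2 hG.2.1, fun hG => h2 hG.1.2.1, fun hG => h2 hG.2.2.1⟩

/-! ## §4 The shape obstruction: a two-window coupling is not a product over windows -/

/-- PROVED: an open product presentation is a product presentation. [folklore] -/
theorem IsWindowwiseOpen.isWindowwise {S : Set Datum} (hS : IsWindowwiseOpen S) : IsWindowwise S :=
  let ⟨U, _, hU⟩ := hS; ⟨U, hU⟩

/-- **PROVED — THE EXCHANGE PROPERTY of window-wise classes:** if `S` is a product over windows and `d, d' ∈ S`, then
the datum equal to `d'` at one window and to `d` at every other window is again in `S`. [folklore] -/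
theorem IsWindowwise.mem_of_mix {S : Set Datum} (hS : IsWindowwise S) {d d' e : Datum} (hd : d ∈ S)
    (hd' : d' ∈ S) (win : Window) (h₁ : e win = d' win) (h₂ : ∀ w, w ≠ win → e w = d w) : e ∈ S := by
  obtain ⟨V, rfl⟩ := hS
  have hdV : (∀ w, d w ∈ V w) ∧ ∀ w, d' w ∈ V w := ⟨hd, hd'⟩
  refine fun w => ?_
  by_cases hw : w = win
  · rw [hw, h₁]; exact hdV.2 win
  · rw [h₂ w hw]; exact hdV.1 w

/-- PROVED: nonnegative constant data are members of every transport twin with `c ≤ 1` and a monotone nonnegative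
gauge (`c Φ(a) b ≤ Φ(a') b`). [folklore] -/
theorem scalarDatum_const_mem_transportTwin {a₀ h c b : ℝ} {Φ : ℝ → ℝ} {T : Set Window} (hb : 0 ≤ b)
    (hc : c ≤ 1) (hΦ : Monotone Φ) (hΦ0 : ∀ a, 0 ≤ Φ a) :
    scalarDatum (fun _ => b) ∈ transportTwin a₀ h c Φ T := by
  simp only [transportTwin, mem_setOf_eq, bottomRayleigh_scalarDatum]
  intro N a a' ha ha' _ _ _ hlt _
  have h1 : Φ a * b ≤ Φ a' * b := mul_le_mul_of_nonneg_right (hΦ hlt.le) hb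
  have h2 : c * (Φ a * b) ≤ 1 * (Φ a * b) := mul_le_mul_of_nonneg_right hc (mul_nonneg (hΦ0 a) hb)
  linarith

/-- **PROVED — A TRANSPORT TWIN IS NOT WINDOW-WISE** as soon as its window set contains one admissible pair
(`0 < c ≤ 1`, gauge monotone and positive): exchange the lower block of the member `1` into the member `0`; the law
at the pair then reads `c Φ(a) · 1 ≤ Φ(a') · 0`. The argument never uses (non-)strictness of the inequality. [folklore] -/
theorem not_isWindowwise_transportTwin {a₀ h c : ℝ} {Φ : ℝ → ℝ} {T : Set Window} (hc : 0 < c) (hc1 : c ≤ 1)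
    (hΦ : Monotone Φ) (hΦpos : ∀ a, 0 < Φ a) {N : ℕ} {a a' : ℝ} (ha : 0 < a) (ha' : 0 < a')
    (hT : (⟨a, N, ha⟩ : Window) ∈ T) (hT' : (⟨a', N, ha'⟩ : Window) ∈ T) (h₀ : a₀ ≤ a) (hlt : a < a')
    (hs : a + h ≤ a') : ¬ IsWindowwise (transportTwin a₀ h c Φ T) := by
  intro hS
  have hΦ0 : ∀ x, 0 ≤ Φ x := fun x => (hΦpos x).le
  have hne : (⟨a', N, ha'⟩ : Window) ≠ ⟨a, N, ha⟩ := fun heq => hlt.ne' (congrArg Window.a heq)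
  -- the exchange: block `1` at the lower window, `0` everywhere else
  have he : patchDatum ⟨a, N, ha⟩ 1 0 ∈ transportTwin a₀ h c Φ T :=
    hS.mem_of_mix (scalarDatum_const_mem_transportTwin le_rfl hc1 hΦ hΦ0)
      (scalarDatum_const_mem_transportTwin zero_le_one hc1 hΦ hΦ0) ⟨a, N, ha⟩ (patchDatum_self _ 1 0)
      fun w hw => patchDatum_of_ne hw 1 0
  simp only [transportTwin, mem_setOf_eq] at he
  have key := he N a a' ha ha' hT hT' h₀ hlt hs
  rw [patchDatum_self, patchDatum_of_ne hne, bottomRayleigh_scalarDatum, bottomRayleigh_scalarDatum] at key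
  nlinarith [hΦpos a]

/-- **PROVED — NO `InG1cont` / `InG1contU` / `InG1int` CERTIFICATE CAN EXIST** for a transport twin with one admissible
pair in its window set: clause (1) of each class is a PRODUCT presentation (`IsWindowwiseOpen`, resp. `IsWindowwise`),
which §4 refutes. This is the formal content behind RULING A101 (a1)'s "certificate not issued". [folklore] -/
theorem not_inG1_transportTwin {a₀ h c : ℝ} {Φ : ℝ → ℝ} {T : Set Window} (hc : 0 < c) (hc1 : c ≤ 1)
    (hΦ : Monotone Φ) (hΦpos : ∀ a, 0 < Φ a) {N : ℕ} {a a' : ℝ} (ha : 0 < a) (ha' : 0 < a')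
    (hT : (⟨a, N, ha⟩ : Window) ∈ T) (hT' : (⟨a', N, ha'⟩ : Window) ∈ T) (h₀ : a₀ ≤ a) (hlt : a < a')
    (hs : a + h ≤ a') :
    ¬ IsWindowwiseOpen (transportTwin a₀ h c Φ T) ∧ ¬ InG1cont (transportTwin a₀ h c Φ T) ∧
      ¬ InG1contU (transportTwin a₀ h c Φ T) ∧ ¬ InG1int (transportTwin a₀ h c Φ T) :=
  have hW := not_isWindowwise_transportTwin hc hc1 hΦ hΦpos ha ha' hT hT' h₀ hlt hs
  ⟨fun h1 => hW h1.isWindowwise, fun hG => hW hG.1.isWindowwise, fun hG => hW hG.1.1.isWindowwise,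
    fun hG => hW hG.1⟩

/-! ## §5 Clause (2) holds on the full window set: decided at no bounded height -/

/-- **PROVED — THE ∀a LAW IS NON-LOCAL AT EVERY HEIGHT** (`T = univ`, `0 ≤ c ≤ 1`, gauge monotone and positive):
above any height `A` patch the member `1` to the block `-1` at one window; the law from the window one stride below
fails, and the patched window is not below `A`. [folklore] -/
theorem nonlocalAtEveryHeight_transportTwin_univ {a₀ h c : ℝ} {Φ : ℝ → ℝ} (hc : 0 ≤ c) (hc1 : c ≤ 1)
    (hΦ : Monotone Φ) (hΦpos : ∀ a, 0 < Φ a) : NonlocalAtEveryHeight (transportTwin a₀ h c Φ univ) := by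
  intro A
  -- lower window at height `a₁ > max(A, a₀, 0)`, patched window one stride (and one unit) above it
  have hm : A ≤ max (max A a₀) 0 ∧ a₀ ≤ max (max A a₀) 0 :=
    ⟨(le_max_left _ _).trans (le_max_left _ _), (le_max_right _ _).trans (le_max_left _ _)⟩
  obtain ⟨a₁, hA, h₀, ha₁⟩ : ∃ a₁ : ℝ, A < a₁ ∧ a₀ ≤ a₁ ∧ 0 < a₁ :=
    ⟨max (max A a₀) 0 + 1, by linarith [hm.1], by linarith [hm.2], by positivity⟩
  have hh : h ≤ max h 0 := le_max_left _ _
  have ha₂ : 0 < a₁ + max h 0 + 1 := by positivity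
  have hne : (⟨a₁, 0, ha₁⟩ : Window) ≠ ⟨a₁ + max h 0 + 1, 0, ha₂⟩ :=
    fun heq => by have := congrArg Window.a heq; simp only at this; linarith [le_max_right h 0]
  refine not_determinedOn_of_exit (scalarDatum_const_mem_transportTwin zero_le_one hc1 hΦ fun x => (hΦpos x).le)
    ?_ (win₀ := ⟨a₁ + max h 0 + 1, 0, ha₂⟩) (fun hle => ?_) (d := patchDatum ⟨a₁ + max h 0 + 1, 0, ha₂⟩ (-1) 1)
    fun win hwin => patchDatum_of_ne hwin _ _
  · intro hd
    simp only [transportTwin, mem_setOf_eq] at hd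
    have key := hd 0 a₁ (a₁ + max h 0 + 1) ha₁ ha₂ (mem_univ _) (mem_univ _) h₀ (by linarith [le_max_right h 0])
      (by linarith)
    rw [patchDatum_of_ne hne, patchDatum_self, bottomRayleigh_scalarDatum, bottomRayleigh_scalarDatum] at key
    nlinarith [hΦpos a₁, hΦpos (a₁ + max h 0 + 1)]
  · exact (not_le.2 (by linarith [le_max_right h 0] : A < a₁ + max h 0 + 1)) hle

/-- **PROVED — PLACEMENT OF THE ∀a LAW (`T = univ`, `0 < c ≤ 1`):** non-local at every height (so NOT finitely
determined: outside W1's class, as door E1 says), yet NOT window-wise — so in none of `G1-cont`, `G1-contU`, `G1-int`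
as typed. [folklore] -/
theorem transportTwin_univ_placement {a₀ h c : ℝ} {Φ : ℝ → ℝ} (hc : 0 < c) (hc1 : c ≤ 1) (hΦ : Monotone Φ)
    (hΦpos : ∀ a, 0 < Φ a) :
    NonlocalAtEveryHeight (transportTwin a₀ h c Φ univ) ∧ ¬ FinitelyDetermined (transportTwin a₀ h c Φ univ) ∧
      ¬ IsWindowwise (transportTwin a₀ h c Φ univ) ∧ ¬ InG1cont (transportTwin a₀ h c Φ univ) ∧
        ¬ InG1contU (transportTwin a₀ h c Φ univ) ∧ ¬ InG1int (transportTwin a₀ h c Φ univ) := by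
  have hnl := nonlocalAtEveryHeight_transportTwin_univ hc.le hc1 hΦ hΦpos (a₀ := a₀) (h := h)
  have h1 : 0 < max a₀ 0 + 1 := by positivity
  have h2 : 0 < max a₀ 0 + 1 + max h 0 + 1 := by positivity
  have hm₁ : a₀ ≤ max a₀ 0 := le_max_left _ _
  have hm₂ : h ≤ max h 0 := le_max_left _ _
  have hm₃ : 0 ≤ max h 0 := le_max_right _ _
  have hW : ¬ IsWindowwise (transportTwin a₀ h c Φ univ) :=
    not_isWindowwise_transportTwin (a₀ := a₀) (h := h) (T := univ) (N := 0) (a := max a₀ 0 + 1)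
      (a' := max a₀ 0 + 1 + max h 0 + 1) hc hc1 hΦ hΦpos h1 h2 (mem_univ _) (mem_univ _) (by linarith)
      (by linarith) (by linarith)
  exact ⟨hnl, hnl.not_finitelyDetermined, hW, fun hG => hW hG.1.isWindowwise, fun hG => hW hG.1.1.isWindowwise,
    fun hG => hW hG.1⟩

/-- PROVED (members of record): `monoFTwin a₀ univ` and `monoFStrideTwin a₀ univ` are non-local at every height,
not window-wise, and not `InG1contU`. [folklore] -/
theorem monoFTwin_univ_placement (a₀ : ℝ) :
    (NonlocalAtEveryHeight (monoFTwin a₀ univ) ∧ ¬ IsWindowwise (monoFTwin a₀ univ) ∧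
      ¬ InG1contU (monoFTwin a₀ univ)) ∧ (NonlocalAtEveryHeight (monoFStrideTwin a₀ univ) ∧
      ¬ IsWindowwise (monoFStrideTwin a₀ univ) ∧ ¬ InG1contU (monoFStrideTwin a₀ univ)) :=
  have h₁ := transportTwin_univ_placement (a₀ := a₀) (h := 0) (c := 0.76) (by norm_num) (by norm_num)
    archGauge_monotone archGauge_pos
  have h₂ := transportTwin_univ_placement (a₀ := a₀) (h := 0.04) (c := 1) one_pos le_rfl archGauge_monotone
    archGauge_pos
  ⟨⟨h₁.1, h₁.2.2.1, h₁.2.2.2.2.1⟩, ⟨h₂.1, h₂.2.2.1, h₂.2.2.2.2.1⟩⟩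

/-! ## §6 Strength: what membership of `ζ` would say (CONDITIONAL reductions; credit nothing) -/

/-- **PROVED — SELF-SEEDING (`h = 0`, `0 ≤ c < 1`):** every member has a NONNEGATIVE bottom at every window `(a', N)`
with an admissible predecessor `a` (`0 < a`, `a₀ ≤ a < a'`) and the slab `[a, a'] × {N}` in `T`: chaining the law
through midpoints gives `c^{n+1} Φ(a) ε₁(a) ≤ Φ(a') ε₁(a')` for every `n`, and `c^{n+1} → 0`. [folklore] -/
theorem bottomRayleigh_nonneg_of_mem_transportTwin {a₀ c : ℝ} {Φ : ℝ → ℝ} {T : Set Window} (hc : 0 ≤ c)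
    (hc1 : c < 1) (hΦpos : ∀ a, 0 < Φ a) {d : Datum} (hd : d ∈ transportTwin a₀ 0 c Φ T) {N : ℕ} {a a' : ℝ}
    (ha : 0 < a) (ha' : 0 < a') (h₀ : a₀ ≤ a) (hlt : a < a')
    (hT : ∀ (x : ℝ) (hx : 0 < x), a ≤ x → x ≤ a' → (⟨x, N, hx⟩ : Window) ∈ T) :
    0 ≤ bottomRayleigh (d ⟨a', N, ha'⟩) := by
  simp only [transportTwin, mem_setOf_eq] at hd
  -- the gauged bottom along the slab, extended by `0` to non-positive heights
  set G : ℝ → ℝ := fun x => if hx : 0 < x then Φ x * bottomRayleigh (d ⟨x, N, hx⟩) else 0 with hG_def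
  have hG : ∀ (x : ℝ) (hx : 0 < x), G x = Φ x * bottomRayleigh (d ⟨x, N, hx⟩) := fun x hx => by
    simp only [hG_def, dif_pos hx]
  have hlaw : ∀ x y : ℝ, a ≤ x → x < y → y ≤ a' → c * G x ≤ G y := by
    intro x y hax hxy hya'
    have hx : 0 < x := ha.trans_le hax
    have hy : 0 < y := hx.trans hxy
    rw [hG x hx, hG y hy]
    exact hd N x y hx hy (hT x hx hax (hxy.le.trans hya')) (hT y hy (hax.trans hxy.le) hya') (h₀.trans hax) hxy
      (by simpa using hxy.le)
  have P : ∀ (n : ℕ) (x : ℝ), a ≤ x → x < a' → c ^ (n + 1) * G x ≤ G a' := by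
    intro n
    induction n with
    | zero =>
      intro x hax hxa'
      simpa using hlaw x a' hax hxa' le_rfl
    | succ n ih =>
      intro x hax hxa'
      have hm₁ : x < (x + a') / 2 := by linarith
      have hm₂ : (x + a') / 2 < a' := by linarith
      have h1 := hlaw x ((x + a') / 2) hax hm₁ hm₂.le
      have h2 := ih ((x + a') / 2) (by linarith) hm₂
      have hcn : 0 ≤ c ^ (n + 1) := pow_nonneg hc _
      calc c ^ (n + 1 + 1) * G x = c ^ (n + 1) * (c * G x) := by ring
        _ ≤ c ^ (n + 1) * G ((x + a') / 2) := mul_le_mul_of_nonneg_left h1 hcn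
        _ ≤ G a' := h2
  have hlim : Tendsto (fun n : ℕ => c ^ (n + 1) * G a) atTop (𝓝 (0 * G a)) :=
    ((tendsto_pow_atTop_nhds_zero_of_lt_one hc hc1).comp (tendsto_add_atTop_nat 1)).mul_const _
  rw [zero_mul] at hlim
  have hGa' : 0 ≤ G a' := le_of_tendsto' hlim fun n => P n a le_rfl hlt
  rw [hG a' ha'] at hGa'
  exact (mul_nonneg_iff_of_pos_left (hΦpos a')).1 hGa'

/-- PROVED (`T = univ`, `h = 0`, `0 ≤ c < 1`): every member is nonnegative at every window above `max a₀ 0` — NO datum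
negative past `max a₀ 0` is a member (kernel form of RULING A104's "thermometer-carried"). [folklore] -/
theorem bottomRayleigh_nonneg_of_mem_transportTwin_univ {a₀ c : ℝ} {Φ : ℝ → ℝ} (hc : 0 ≤ c) (hc1 : c < 1)
    (hΦpos : ∀ a, 0 < Φ a) {d : Datum} (hd : d ∈ transportTwin a₀ 0 c Φ univ) (win : Window)
    (hwin : max a₀ 0 < win.a) : 0 ≤ bottomRayleigh (d win) := by
  obtain ⟨a', N, ha'⟩ := win
  dsimp only at hwin
  have h0 : 0 ≤ max a₀ 0 ∧ a₀ ≤ max a₀ 0 := ⟨le_max_right _ _, le_max_left _ _⟩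
  exact bottomRayleigh_nonneg_of_mem_transportTwin hc hc1 hΦpos hd (a := (max a₀ 0 + a') / 2) (by linarith) ha'
    (by linarith) (by linarith) fun _ _ _ _ => mem_univ _

/-- PROVED: nonnegative bottoms at every truncation are the Galerkin floor `0` at that height. [folklore] -/
theorem galerkinFloorAt_zero_of_nonneg {a : ℝ} (ha : 0 < a) (h : ∀ N, 0 ≤ bottomRayleigh (zetaDatum ⟨a, N, ha⟩)) :
    GalerkinFloorAt a ha 0 := by
  intro N v
  have h1 := bottomRayleigh_mul_le_form (zetaDatum ⟨a, N, ha⟩) v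
  have h2 := dotProduct_self_nonneg_real v
  nlinarith [h N]

/-- PROVED (RH-STRENGTH label E1; CONDITIONAL, no RH claim): nonnegative Galerkin bottoms of `ζ` at EVERY window above
some height imply RH (`riemannHypothesis_of_galerkinFloorSeq`, floors `0`). Nobody has such bottoms. [folklore] -/
theorem riemannHypothesis_of_eventually_nonneg {A : ℝ}
    (h : ∀ win : Window, A < win.a → 0 ≤ bottomRayleigh (zetaDatum win)) : RiemannHypothesis := by
  have hpos : ∀ k : ℕ, 0 < max A 0 + 1 + (k : ℝ) := fun k => by positivity
  refine riemannHypothesis_of_galerkinFloorSeq (a := fun k : ℕ => max A 0 + 1 + k) (σ := fun _ => 0) hpos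
    (tendsto_atTop_add_const_left _ _ tendsto_natCast_atTop_atTop) tendsto_const_nhds fun k => ?_
  exact galerkinFloorAt_zero_of_nonneg (hpos k) fun N => h _ (by
    show A < max A 0 + 1 + (k : ℝ)
    linarith [le_max_left A 0, (k.cast_nonneg : (0 : ℝ) ≤ k)])

/-- **PROVED (RH-STRENGTH label E1; CONDITIONAL, no RH claim) — THE ALL-STRIDES TWIN IS SELF-SEEDING:** for
`0 ≤ c < 1` and ANY `a₀`, `ζ ∈ transportTwin a₀ 0 c Φ univ` implies RH (no seed needed). Nobody has the membership;
DATA has it on 1865 served rows only — a bounded restriction (§3, inside W1). [folklore] -/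
theorem riemannHypothesis_of_zeta_mem_transportTwin {a₀ c : ℝ} {Φ : ℝ → ℝ} (hc : 0 ≤ c) (hc1 : c < 1)
    (hΦpos : ∀ a, 0 < Φ a) (hζ : zetaDatum ∈ transportTwin a₀ 0 c Φ univ) : RiemannHypothesis :=
  riemannHypothesis_of_eventually_nonneg fun win hwin =>
    bottomRayleigh_nonneg_of_mem_transportTwin_univ hc hc1 hΦpos hζ win hwin

/-- **PROVED (RH-STRENGTH label E1; CONDITIONAL, no RH claim) — SEEDED TRANSPORT:** for any `c > 0`, any stride `h`
and any gauge `Φ > 0`, a seed height `aₛ ≥ a₀` with `0 < ε_ev(aₛ)` plus membership of `ζ` in the twin on `univ`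
gives `ε₁ > 0` at every window of height `> aₛ + |h|` (Rayleigh–Ritz `weilEvenGroundEnergy_le_bottomRayleigh'`
makes the seed uniform in `N`), hence RH. The datum-side twin of `riemannHypothesis_of_archTransportFrom'`. [folklore] -/
theorem riemannHypothesis_of_zeta_mem_transportTwin_of_seed {a₀ h c : ℝ} {Φ : ℝ → ℝ} (hc : 0 < c)
    (hΦpos : ∀ a, 0 < Φ a) {aₛ : ℝ} (haₛ : 0 < aₛ) (h₀ : a₀ ≤ aₛ) (hseed : 0 < weilEvenGroundEnergy aₛ)
    (hζ : zetaDatum ∈ transportTwin a₀ h c Φ univ) : RiemannHypothesis := by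
  refine riemannHypothesis_of_eventually_nonneg (A := aₛ + |h|) fun win hwin => ?_
  obtain ⟨a', N, ha'⟩ := win
  dsimp only at hwin
  simp only [transportTwin, mem_setOf_eq] at hζ
  have hlaw := hζ N aₛ a' haₛ ha' (mem_univ _) (mem_univ _) h₀ (by linarith [abs_nonneg h])
    (by linarith [le_abs_self h])
  have hpos : 0 < bottomRayleigh (zetaDatum ⟨aₛ, N, haₛ⟩) :=
    hseed.trans_le (weilEvenGroundEnergy_le_bottomRayleigh' ⟨aₛ, N, haₛ⟩)
  have hpos' : 0 < Φ a' * bottomRayleigh (zetaDatum ⟨a', N, ha'⟩) :=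
    (mul_pos hc (mul_pos (hΦpos aₛ) hpos)).trans_le hlaw
  exact ((mul_pos_iff_of_pos_left (hΦpos a')).1 hpos').le

/-- **PROVED (RH-STRENGTH label E1; CONDITIONAL, no RH claim) — SEEDED FROM THE PROVED RUNG:** if `a₀ < log 3 / 2`
the seed exists unconditionally (`weilGroundEnergy_pos_of_lt_log_three_half'`, `ε ≤ ε_ev`), so membership of `ζ`
in ANY twin `transportTwin a₀ h c Φ univ` with `c > 0`, `Φ > 0` implies RH. [folklore] -/
theorem riemannHypothesis_of_zeta_mem_transportTwin_of_lt_log_three_half {a₀ h c : ℝ} {Φ : ℝ → ℝ} (hc : 0 < c)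
    (hΦpos : ∀ a, 0 < Φ a) (ha₀ : a₀ < Real.log 3 / 2) (hζ : zetaDatum ∈ transportTwin a₀ h c Φ univ) :
    RiemannHypothesis := by
  have hL : 0 < Real.log 3 := Real.log_pos (by norm_num)
  have hmax : max a₀ 0 < Real.log 3 / 2 := max_lt ha₀ (by linarith)
  have hm : 0 ≤ max a₀ 0 ∧ a₀ ≤ max a₀ 0 := ⟨le_max_right _ _, le_max_left _ _⟩
  have h1 : 0 < (max a₀ 0 + Real.log 3 / 2) / 2 := by linarith
  exact riemannHypothesis_of_zeta_mem_transportTwin_of_seed hc hΦpos h1 (by linarith)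
    ((weilGroundEnergy_pos_of_lt_log_three_half' h1 (by linarith)).trans_le
      (weilGroundEnergy_le_weilEvenGroundEnergy _)) hζ

/-- PROVED (members of record; RH-STRENGTH label E1, CONDITIONAL, no RH claim): `ζ ∈ monoFTwin a₀ univ ⇒ RH` for
EVERY `a₀` (self-seeding, `c = 0.76 < 1`), and `ζ ∈ monoFStrideTwin a₀ univ ⇒ RH` for `a₀ < log 3 / 2` (seeded).
Nobody has either membership. [folklore] -/
theorem riemannHypothesis_of_zeta_mem_monoFTwin (a₀ : ℝ) :
    (zetaDatum ∈ monoFTwin a₀ univ → RiemannHypothesis) ∧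
      (a₀ < Real.log 3 / 2 → zetaDatum ∈ monoFStrideTwin a₀ univ → RiemannHypothesis) :=
  ⟨fun hζ => riemannHypothesis_of_zeta_mem_transportTwin (by norm_num) (by norm_num) archGauge_pos hζ,
    fun ha₀ hζ => riemannHypothesis_of_zeta_mem_transportTwin_of_lt_log_three_half one_pos archGauge_pos ha₀ hζ⟩

end Summit.RiemannHypothesis.RiemannHypothesis.Theorems.PfPersistence

end
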